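import Summits.ValiantsHypothesis.ValiantsHypothesis.Theorems.BarrierLeverPartitionMinorsChowBoundedSize

/-!
# Route BarrierLever — Chow witnesses for partition minors (items 20172 / 20195): the LEAF STEP,
# a third reduction for the core engine (after the rank-one peel and the literal split)

Helper file (`--supports stmt-ValiantsHypothesis-20172`; cell valiant-natproofs, rung V4, 𝒟-side of
door (c); seat val-np-p4 gen 13).  Closes NO item.  Conventions of items 19717 / 20172 / 20195: a
layout `(u, w)` of height `h` (`u w : Fin r → Finset (Fin h)`) is HIT when some product of `h + h`
affine forms has nonsingular partition minor `det[coeff_{E (u i) (w j)} ∏ ℓ]`.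

**The leaf step (`chow_leafStep`).**  Let `(u, w)` be a layout of height `h + 1` and size `r + 1`.
Suppose the row coordinate `a` is LONELY — the `a`-status of one row `u i₁` differs from that of
every other row (every leaf edge of a tree-shaped row side is such; for a star with centre `B` every
coordinate is lonely) — and the column coordinate `c` carries the EDGE `w j₁ = w j₀ ∪ {c}`
(`w j₀ = (w j₁).erase c`, `c ∈ w j₁`; the sizes of the two `c`-classes of the columns are
arbitrary, so LOCKED pairs qualify).  If the REDUCED layout of height `h` and size `r` — drop row
`i₁` and column `j₁`, delete `a` from the rows and `c` from the columns, pull back along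
`a.succAbove` / `c.succAbove` — is hit, then `(u, w)` is hit.  (When `c` has exactly one edge among
the columns the reduced layout is again injective; that bookkeeping is the user's, the step itself
needs no injectivity.)

Proof.  One product `∏ ℓ` of `h + h` forms hits both the reduced layout and the `1 × 1` layout
`((u i₁) \ a, w j₀)` (`exists_common_chow_witness₂`); lift it along `(a, c)` (`…CoordinateLift`)
and multiply by the gadget `(1 + x_a + y_c)²`, whose multilinear coefficients are `1, 2, 2, 2`
(`coeff_squareGadget`).  By `coeff_partitionExpo_mul_pairFactor` the partition matrix is
`M i j = g(a ∈ u i, c ∈ w j) · F i j` with `F i j` the lifted witness's coefficient at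
`((u i) \ a, (w j) \ c)`; the columns `j₁, j₀` of `F` coincide, the rows `i ≠ i₁` of `g` depend on
`j` only, and the `2 × 2` table `g` has determinant `1·2 - 2·2 ≠ 0`.  One column operation
(`col j₁ ← g₀₀' col j₁ - g₀₁' col j₀`) clears column `j₁` except at row `i₁`, and the Laplace
expansion along that column (`Matrix.det_succ_column`) leaves
`± δ · F i₁ j₀ · ∏_j g · det (reduced minor)`, all factors nonzero (`det_ne_zero_of_lonelyRow`).

This is the Chow-witness reduction that neither the peel (`chow_peel`: needs BOTH erasures injective)
nor the split (`chow_pairSplit[_mixed]`: needs a row class and a column class of EQUAL size) covers: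
the column coordinate may have classes of any sizes as long as it carries exactly one edge.

WHAT THIS IS NOT: a reduction step only (it hits nothing by itself; the engine corollary «a minimal
unhit layout admits no leaf step» is a separate file); nothing on items 20172 / 20195 / 19717
themselves, on crux stmt-ValiantsHypothesis-14610, or on `VP` versus `VNP`.
-/

set_option linter.dupNamespace false

namespace Summit.ValiantsHypothesis.ValiantsHypothesis.Theorems.BarrierLever.ChowFactor

open Finset MvPolynomial

noncomputable section

variable {h : ℕ}

/-! ## 1. A determinant lemma: a lonely row against a doubled column -/

/-- **Lonely row × doubled column.**  Let `M i j = v j * F i j` for `i ≠ i₁` and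
`M i₁ j = v₁ j * F i₁ j`, where the columns `j₁ ≠ j₀` of `F` coincide, every `v j ≠ 0`,
`v j₀ * v₁ j₁ ≠ v j₁ * v₁ j₀`, `F i₁ j₀ ≠ 0` and the minor of `F` off row `i₁` and column `j₁` is
nonsingular.  Then `det M ≠ 0`. -/
theorem det_ne_zero_of_lonelyRow {n : ℕ} (M F : Matrix (Fin (n + 1)) (Fin (n + 1)) ℂ)
    (v v₁ : Fin (n + 1) → ℂ) (i₁ j₁ j₀ : Fin (n + 1)) (hj : j₁ ≠ j₀)
    (hM : ∀ i j, i ≠ i₁ → M i j = v j * F i j) (hM₁ : ∀ j, M i₁ j = v₁ j * F i₁ j)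
    (hF : ∀ i, F i j₁ = F i j₀) (hv : ∀ j, v j ≠ 0)
    (hκ : v j₀ * v₁ j₁ - v j₁ * v₁ j₀ ≠ 0) (hent : F i₁ j₀ ≠ 0)
    (hminor : (F.submatrix i₁.succAbove j₁.succAbove).det ≠ 0) : M.det ≠ 0 := by
  classical
  -- the column operation `col j₁ ← v j₀ • col j₁ - v j₁ • col j₀`
  set col : Fin (n + 1) → ℂ := fun i => v j₀ * M i j₁ + (-(v j₁)) * M i j₀ with hcol
  have hdet : (M.updateCol j₁ col).det = v j₀ * M.det := by
    have e : col = v j₀ • (fun i => M i j₁) + (-(v j₁)) • (fun i => M i j₀) := by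
      ext i; simp [hcol]
    have h0 : (M.updateCol j₁ fun i => M i j₀).det = 0 :=
      Matrix.det_zero_of_column_eq hj (fun k => by
        rw [Matrix.updateCol_self, Matrix.updateCol_ne hj.symm])
    rw [e, Matrix.det_updateCol_add, Matrix.det_updateCol_smul, Matrix.det_updateCol_smul,
      Matrix.updateCol_eq_self, h0, mul_zero, add_zero]
  -- the new column vanishes off `i₁`
  have hcol0 : ∀ i, i ≠ i₁ → col i = 0 := by
    intro i hi
    simp only [hcol, hM i j₁ hi, hM i j₀ hi, hF i]
    ring
  have hcol1 : col i₁ = (v j₀ * v₁ j₁ - v j₁ * v₁ j₀) * F i₁ j₀ := by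
    simp only [hcol, hM₁ j₁, hM₁ j₀, hF i₁]
    ring
  -- Laplace along column `j₁`
  have hlap := Matrix.det_succ_column (M.updateCol j₁ col) j₁
  rw [Finset.sum_eq_single i₁] at hlap
  · have hsub : (M.updateCol j₁ col).submatrix i₁.succAbove j₁.succAbove =
        Matrix.of fun k l => v (j₁.succAbove l) * (F.submatrix i₁.succAbove j₁.succAbove) k l := by
      ext k l
      rw [Matrix.submatrix_apply, Matrix.updateCol_ne (Fin.succAbove_ne j₁ l), Matrix.of_apply,
        Matrix.submatrix_apply, hM _ _ (Fin.succAbove_ne i₁ k)]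
    rw [hsub, Matrix.det_mul_row, Matrix.updateCol_self, hcol1, hdet] at hlap
    intro hM0
    rw [hM0, mul_zero] at hlap
    have hprod : (∏ l : Fin n, v (j₁.succAbove l)) ≠ 0 :=
      Finset.prod_ne_zero_iff.mpr fun l _ => hv _
    have hsign : ((-1 : ℂ) ^ ((i₁ : ℕ) + (j₁ : ℕ))) ≠ 0 := pow_ne_zero _ (by norm_num)
    exact (mul_ne_zero (mul_ne_zero hsign (mul_ne_zero hκ hent)) (mul_ne_zero hprod hminor))
      hlap.symm
  · intro i _ hi
    rw [Matrix.updateCol_self, hcol0 i hi, mul_zero, zero_mul]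
  · intro hi
    exact absurd (Finset.mem_univ i₁) hi

/-! ## 2. The gadget `(1 + x_a + y_c)²` -/

/-- The gadget involves only `x_a` and `y_c`. -/
theorem support_squareGadget (a c : Fin (h + 1)) :
    ∀ m ∈ ((C 1 + C 1 * X (Fin.castAdd (h + 1) a) + C 1 * X (Fin.natAdd (h + 1) c)) *
        (C 1 + C 1 * X (Fin.castAdd (h + 1) a) + C 1 * X (Fin.natAdd (h + 1) c)) :
        MvPolynomial (Fin ((h + 1) + (h + 1))) ℂ).support,
      ∀ v, ¬ (v = Fin.castAdd (h + 1) a ∨ v = Fin.natAdd (h + 1) c) → m v = 0 := by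
  classical
  intro m hm v hv
  by_contra hne
  have hvars : v ∈ ((C 1 + C 1 * X (Fin.castAdd (h + 1) a) + C 1 * X (Fin.natAdd (h + 1) c)) *
      (C 1 + C 1 * X (Fin.castAdd (h + 1) a) + C 1 * X (Fin.natAdd (h + 1) c)) :
      MvPolynomial (Fin ((h + 1) + (h + 1))) ℂ).vars :=
    (mem_vars_iff_mem_support v).mpr ⟨m, hm, Finsupp.mem_support_iff.mpr hne⟩
  have hsub : (C 1 + C (1 : ℂ) * X (Fin.castAdd (h + 1) a) + C 1 * X (Fin.natAdd (h + 1) c) :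
      MvPolynomial (Fin ((h + 1) + (h + 1))) ℂ).vars ⊆ {Fin.castAdd (h + 1) a, Fin.natAdd (h + 1) c} := by
    refine (vars_add_subset _ _).trans (Finset.union_subset ((vars_add_subset _ _).trans
      (Finset.union_subset ?_ ?_)) ?_)
    · rw [vars_C]
      exact Finset.empty_subset _
    · refine (vars_mul _ _).trans (Finset.union_subset ?_ ?_)
      · rw [vars_C]
        exact Finset.empty_subset _
      · rw [vars_X]
        exact Finset.singleton_subset_iff.mpr (by simp)
    · refine (vars_mul _ _).trans (Finset.union_subset ?_ ?_)
      · rw [vars_C]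
        exact Finset.empty_subset _
      · rw [vars_X]
        exact Finset.singleton_subset_iff.mpr (by simp)
  have hv' := (vars_mul _ _).trans (Finset.union_subset hsub hsub) hvars
  simp only [Finset.mem_insert, Finset.mem_singleton] at hv'
  exact hv hv'

/-- **The four multilinear coefficients of the gadget** `(1 + x_a + y_c)²`: `1` at `(∅, ∅)` and `2`
at `({a}, ∅)`, `(∅, {c})`, `({a}, {c})`. -/
theorem coeff_squareGadget (a c : Fin (h + 1)) (U W : Finset (Fin (h + 1)))
    (hU : U = ∅ ∨ U = {a}) (hW : W = ∅ ∨ W = {c}) :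
    coeff (∑ a' ∈ U, Finsupp.single (Fin.castAdd (h + 1) a') 1 +
        ∑ c' ∈ W, Finsupp.single (Fin.natAdd (h + 1) c') 1)
      ((C 1 + C 1 * X (Fin.castAdd (h + 1) a) + C 1 * X (Fin.natAdd (h + 1) c)) *
        (C 1 + C 1 * X (Fin.castAdd (h + 1) a) + C 1 * X (Fin.natAdd (h + 1) c)) :
        MvPolynomial (Fin ((h + 1) + (h + 1))) ℂ) =
      if U = ∅ ∧ W = ∅ then 1 else 2 := by
  classical
  rw [← affine_pair_eq a c 1, coeff_partitionExpo_mul_affine, coeff_partitionExpo_affine]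
  simp_rw [coeff_partitionExpo_affine]
  have hane : ({a} : Finset (Fin (h + 1))) ≠ ∅ := Finset.singleton_ne_empty a
  have hcne : ({c} : Finset (Fin (h + 1))) ≠ ∅ := Finset.singleton_ne_empty c
  rcases hU with rfl | rfl <;> rcases hW with rfl | rfl
  all_goals simp [hane, hcne, Finset.sum_singleton]
  all_goals norm_num

/-! ## 3. The leaf step -/

/-- Pulling back along `c.succAbove` forgets whether `c` was present. -/
theorem preimage_succAbove_erase (c : Fin (h + 1)) (S : Finset (Fin (h + 1))) :
    (S.erase c).preimage c.succAbove Fin.succAbove_right_injective.injOn =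
      S.preimage c.succAbove Fin.succAbove_right_injective.injOn := by
  ext k
  simp [Finset.mem_preimage, Finset.mem_erase, Fin.succAbove_ne]

/-- **THE LEAF STEP for Chow witnesses.**  Height `h + 1`, size `r + 1`; the row coordinate `a` is
lonely at row `i₁` (every other row has the opposite `a`-status) and the column coordinate `c`
carries the edge `w j₁ = w j₀ ∪ {c}` (`j₁ ≠ j₀`, `c ∈ w j₁`, `w j₀ = (w j₁).erase c`).  If the reduced
layout — rows `i ≠ i₁` and columns `j ≠ j₁` (listed along `i₁.succAbove`, `j₁.succAbove`), with `a`
deleted from the rows and `c` from the columns and pulled back to height `h` — is hit by a product of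
`h + h` affine forms, then `(u, w)` is hit by a product of `(h+1) + (h+1)` affine forms. -/
theorem chow_leafStep (a c : Fin (h + 1)) {r : ℕ} (u w : Fin (r + 1) → Finset (Fin (h + 1)))
    (i₁ j₁ j₀ : Fin (r + 1)) (hlone : ∀ i, i ≠ i₁ → (a ∈ u i ↔ a ∉ u i₁))
    (hj : j₁ ≠ j₀) (hc : c ∈ w j₁) (hj₀ : w j₀ = (w j₁).erase c)
    (hred : ∃ ℓ : Fin (h + h) → MvPolynomial (Fin (h + h)) ℂ, (∀ q, (ℓ q).totalDegree ≤ 1) ∧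
      (Matrix.of fun k l : Fin r => coeff
        (∑ b ∈ (u (i₁.succAbove k)).preimage a.succAbove Fin.succAbove_right_injective.injOn,
            Finsupp.single (Fin.castAdd h b) 1 +
          ∑ d ∈ (w (j₁.succAbove l)).preimage c.succAbove Fin.succAbove_right_injective.injOn,
            Finsupp.single (Fin.natAdd h d) 1)
        (∏ q, ℓ q)).det ≠ 0) :
    ∃ ℓ : Fin ((h + 1) + (h + 1)) → MvPolynomial (Fin ((h + 1) + (h + 1))) ℂ,
      (∀ q, (ℓ q).totalDegree ≤ 1) ∧
      (Matrix.of fun i j : Fin (r + 1) => coeff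
        (∑ a' ∈ u i, Finsupp.single (Fin.castAdd (h + 1) a') 1 +
          ∑ c' ∈ w j, Finsupp.single (Fin.natAdd (h + 1) c') 1)
        (∏ q, ℓ q)).det ≠ 0 := by
  classical
  -- the `1 × 1` layout `((u i₁) \ a, w j₀)` is hit
  have hone : ∃ ℓ : Fin (h + h) → MvPolynomial (Fin (h + h)) ℂ, (∀ q, (ℓ q).totalDegree ≤ 1) ∧
      (Matrix.of fun _ _ : Fin 1 => coeff
        (∑ b ∈ (u i₁).preimage a.succAbove Fin.succAbove_right_injective.injOn,
            Finsupp.single (Fin.castAdd h b) 1 +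
          ∑ d ∈ (w j₀).preimage c.succAbove Fin.succAbove_right_injective.injOn,
            Finsupp.single (Fin.natAdd h d) 1)
        (∏ q, ℓ q)).det ≠ 0 :=
    chowHits_of_size_le_three h 1 (by norm_num) _ _ (Function.injective_of_subsingleton _)
      (Function.injective_of_subsingleton _)
  obtain ⟨ℓ, hdeg, hA, hD⟩ := exists_common_chow_witness₂ _ _ _ _ hred hone
  rw [Matrix.det_fin_one, Matrix.of_apply] at hD
  -- the lift and the gadget
  set L : Fin (h + h) → Fin ((h + 1) + (h + 1)) := Fin.append
    (fun b : Fin h => Fin.castAdd (h + 1) (a.succAbove b))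
    (fun d : Fin h => Fin.natAdd (h + 1) (c.succAbove d)) with hL
  set f₁ : MvPolynomial (Fin ((h + 1) + (h + 1))) ℂ :=
    C 1 + C 1 * X (Fin.castAdd (h + 1) a) + C 1 * X (Fin.natAdd (h + 1) c) with hf₁
  have hcard : (h + h) + 2 = (h + 1) + (h + 1) := by omega
  set e : Fin ((h + h) + 2) ≃ Fin ((h + 1) + (h + 1)) := finCongr hcard with he
  set ℓ' : Fin ((h + h) + 2) → MvPolynomial (Fin ((h + 1) + (h + 1))) ℂ :=
    Fin.append (fun q => rename L (ℓ q)) ![f₁, f₁] with hℓ'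
  refine ⟨fun q => ℓ' (e.symm q), fun q => ?_, ?_⟩
  · show (ℓ' (e.symm q)).totalDegree ≤ 1
    generalize e.symm q = q₀
    rw [hℓ']
    induction q₀ using Fin.addCases with
    | left q' =>
      rw [Fin.append_left]
      exact totalDegree_rename_le_one L (ℓ q') (hdeg q')
    | right q' =>
      rw [Fin.append_right]
      fin_cases q'
      · exact totalDegree_affine_pair_le a c 1
      · exact totalDegree_affine_pair_le a c 1
  · -- the product
    have hprod : (∏ q, ℓ' (e.symm q)) = (f₁ * f₁) * rename L (∏ q, ℓ q) := by
      rw [Fintype.prod_equiv e.symm (fun q => ℓ' (e.symm q)) ℓ' (fun _ => rfl), hℓ',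
        Fin.prod_univ_add]
      simp only [Fin.append_left, Fin.append_right, Fin.prod_univ_two, Matrix.cons_val_zero,
        Matrix.cons_val_one]
      rw [map_prod, mul_comm]
    rw [hprod]
    -- entries of the partition matrix: gadget coefficient × lifted coefficient
    set F : Matrix (Fin (r + 1)) (Fin (r + 1)) ℂ := Matrix.of fun i j => coeff
        (∑ b ∈ (u i).preimage a.succAbove Fin.succAbove_right_injective.injOn,
            Finsupp.single (Fin.castAdd h b) 1 +
          ∑ d ∈ (w j).preimage c.succAbove Fin.succAbove_right_injective.injOn,
            Finsupp.single (Fin.natAdd h d) 1) (∏ q, ℓ q) with hFdef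
    have hentry : ∀ i j : Fin (r + 1), coeff
        (∑ a' ∈ u i, Finsupp.single (Fin.castAdd (h + 1) a') 1 +
          ∑ c' ∈ w j, Finsupp.single (Fin.natAdd (h + 1) c') 1) ((f₁ * f₁) * rename L (∏ q, ℓ q)) =
        (if a ∉ u i ∧ c ∉ w j then (1 : ℂ) else 2) * F i j := by
      intro i j
      rw [coeff_partitionExpo_mul_pairFactor _ _ a c (support_squareGadget a c)
        (support_rename_lift a c _) (u i) (w j)]
      have hfa : (u i).filter (fun a' => a' = a) = u i ∩ {a} := by
        ext x; simp [Finset.mem_filter, Finset.mem_inter]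
      have hfc : (w j).filter (fun c' => c' = c) = w j ∩ {c} := by
        ext x; simp [Finset.mem_filter, Finset.mem_inter]
      rw [hfa, hfc, coeff_squareGadget a c _ _ ?_ ?_, erase_eq_map_preimage_succAbove,
        erase_eq_map_preimage_succAbove, coeff_lift_rename, hFdef, Matrix.of_apply]
      · have hane : ({a} : Finset (Fin (h + 1))) ≠ ∅ := Finset.singleton_ne_empty a
        have hcne : ({c} : Finset (Fin (h + 1))) ≠ ∅ := Finset.singleton_ne_empty c
        by_cases ha : a ∈ u i <;> by_cases hc' : c ∈ w j <;>
          simp [Finset.inter_singleton_of_mem, Finset.inter_singleton_of_notMem, ha, hc', hane, hcne]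
      · by_cases ha : a ∈ u i
        · right; rw [Finset.inter_singleton_of_mem ha]
        · left; rw [Finset.inter_singleton_of_notMem ha]
      · by_cases hc' : c ∈ w j
        · right; rw [Finset.inter_singleton_of_mem hc']
        · left; rw [Finset.inter_singleton_of_notMem hc']
    -- the two columns `j₁, j₀` of `F` coincide
    have hc₀ : c ∉ w j₀ := by rw [hj₀]; exact Finset.notMem_erase c _
    have hFcol : ∀ i, F i j₁ = F i j₀ := by
      intro i
      rw [hFdef, Matrix.of_apply, Matrix.of_apply, hj₀, preimage_succAbove_erase]
    -- apply the determinant lemma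
    refine det_ne_zero_of_lonelyRow _ F
      (fun j => if a ∈ u i₁ ∧ c ∉ w j then (1 : ℂ) else 2)
      (fun j => if a ∉ u i₁ ∧ c ∉ w j then (1 : ℂ) else 2) i₁ j₁ j₀ hj ?_ ?_ hFcol ?_ ?_ hD ?_
    · intro i j hi
      rw [Matrix.of_apply, hentry]
      have hst : a ∉ u i ↔ a ∈ u i₁ := by
        have := hlone i hi
        tauto
      simp only [hst]
    · intro j
      rw [Matrix.of_apply, hentry]
    · intro j
      split_ifs <;> norm_num
    · simp only [hc, hc₀, not_true_eq_false, not_false_eq_true, and_true, and_false, if_false]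
      by_cases ha : a ∈ u i₁ <;> simp [ha] <;> norm_num
    · -- the reduced minor is the reduced layout's partition matrix
      have hsub : F.submatrix i₁.succAbove j₁.succAbove = Matrix.of fun k l : Fin r => coeff
          (∑ b ∈ (u (i₁.succAbove k)).preimage a.succAbove Fin.succAbove_right_injective.injOn,
              Finsupp.single (Fin.castAdd h b) 1 +
            ∑ d ∈ (w (j₁.succAbove l)).preimage c.succAbove Fin.succAbove_right_injective.injOn,
              Finsupp.single (Fin.natAdd h d) 1) (∏ q, ℓ q) := by
        ext k l
        rw [Matrix.submatrix_apply, hFdef, Matrix.of_apply, Matrix.of_apply]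
      rw [hsub]
      exact hA

end

end Summit.ValiantsHypothesis.ValiantsHypothesis.Theorems.BarrierLever.ChowFactor
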